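import Summits.Ventures.QEC.Census.GB.S8_65_w6_k10_020B015.Data
import HarnessLib

/-!
# Census row `2bga-g65-A0.20-B0.1.5.16` — Brouwer–Zimmermann block verdicts 12…17 of the `Z` side (549900 codeword visits; fast twin `bzZBlockF`, `decide +kernel`, tier KERNEL). Part 3/4.
-/

set_option Elab.async false

namespace Summit.Ventures.QEC.Census.S8_65_w6_k10_020B015

/-- Block 12 of the `Z` side replays (91650 codeword visits; fast twin `bzZBlockF`, `decide +kernel`). -/
theorem blkZ_12 : S8_65_w6_k10_020B015.cert.bzZBlockF S8_65_w6_k10_020B015.bz 12 = true := by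
  decide +kernel

/-- Block 13 of the `Z` side replays (91650 codeword visits; fast twin `bzZBlockF`, `decide +kernel`). -/
theorem blkZ_13 : S8_65_w6_k10_020B015.cert.bzZBlockF S8_65_w6_k10_020B015.bz 13 = true := by
  decide +kernel

/-- Block 14 of the `Z` side replays (91650 codeword visits; fast twin `bzZBlockF`, `decide +kernel`). -/
theorem blkZ_14 : S8_65_w6_k10_020B015.cert.bzZBlockF S8_65_w6_k10_020B015.bz 14 = true := by
  decide +kernel

/-- Block 15 of the `Z` side replays (91650 codeword visits; fast twin `bzZBlockF`, `decide +kernel`). -/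
theorem blkZ_15 : S8_65_w6_k10_020B015.cert.bzZBlockF S8_65_w6_k10_020B015.bz 15 = true := by
  decide +kernel

/-- Block 16 of the `Z` side replays (91650 codeword visits; fast twin `bzZBlockF`, `decide +kernel`). -/
theorem blkZ_16 : S8_65_w6_k10_020B015.cert.bzZBlockF S8_65_w6_k10_020B015.bz 16 = true := by
  decide +kernel

/-- Block 17 of the `Z` side replays (91650 codeword visits; fast twin `bzZBlockF`, `decide +kernel`). -/
theorem blkZ_17 : S8_65_w6_k10_020B015.cert.bzZBlockF S8_65_w6_k10_020B015.bz 17 = true := by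
  decide +kernel

end Summit.Ventures.QEC.Census.S8_65_w6_k10_020B015
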